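import Literature.NumberTheory.GaloisCohomology.RestrictedRamificationExtOneLayerNat
import Literature.NumberTheory.GaloisRepresentations.IdeleBarKSInflationClassMap
import Literature.NumberTheory.GaloisRepresentations.IdeleBarKSInflationBoundary
import Literature.NumberTheory.GaloisRepresentations.HomDualIdeleReadoutSExt
import HarnessLib

/-!
# The `G_S`-side class of (R4)_S read in `C_{Γ_K}`: `Inf(nat_S y ∘ δ_S[f] ∘ [I_S → C_{K_S}]) ≫ counit = Φ⁻¹(inf y) ∘ ∂(presSharp f ≫ g)`
# (Milne *ADT* I, proof of Thm. 4.10 (p. 58) for `G_S`; Harari §4.3 Remark 4.24, Prop. 17.26)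

Topic `NumberTheory/GaloisRepresentations`; namespace `Literature.NumberTheory.GaloisRepresentations.IdeleClassBar`.  THEOREMS ONLY
(no definition, no named fact, no instance, no notation, no `sorry`).  Cell bsd-eis, lane «PT-Ш-S-TC», crux `GoodLatticeBDPValue`
(stmt-BirchSwinnertonDyer-19032), brick D4b/F2d (`F2D-SCOPING-w6g11.md` §2): the composite of steps (a) (-w6 g11,
`IdeleBarKSInflationBoundary`), (b) (`IdeleBarKSInflationClassMap`) and (d) (`RestrictedRamificationExtOneLayerNat`).

THE MATHEMATICS.  `K` a number field, `S` a finite set of finite places, `N_S`, `G_S = Γ_K ⧸ N_S`, `ρ₀` a finite Galois module unramified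
outside `S` (`hur : N_S ≤ ker ρ₀`) with its canonical presentation `T : 0 → N₁ → P → M₀ → 0` in `C_{Γ_K}` and `S`-presentation
`T_S : 0 → N₁^S → P^S → M₀^{N_S} → 0` in `C_{G_S}`.  For a `G_S`-morphism `f : N₁^S ⟶ I_S` and a class `y ∈ H¹(G_S, M₀^{N_S})`, the
argument of `inv_{K_S}` in the reciprocity law (R4)_S on Milne's `Ext` road — after (★1) `inv_S ∘ (C_{K_S} ↠ C̄_S)_* = inv_{K_S}` — is
the class `X(f, y) := nat_S y ∘ δ_S[f] ∘ [I_S → C_{K_S}] ∈ Ext²_{C_{G_S}}(ℤ, C_{K_S})` (`nat_S` the layer bridge of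
`RestrictedRamificationExtOneLayerNat`, `δ_S[f] = HomDual.bdrySHom`).  **Theorem
(`inflExtHomTriv_natLayerS_bdryS_truncToClassKSD_comp_invariantsInclQuot`).**  In `Ext²_{C_{Γ_K}}(ℤ, C̄)`,

  `Inf_{N_S} X(f, y) ≫ [Inf(C̄^{N_S}) ↪ C̄] = Φ⁻¹(inf y) ∘ ∂_T (presSharp f ≫ (J̄ ↠ C̄))`,

where `Φ = OpenLayer.extOneEquiv ρ₀` is door-c5's degree-`1` bridge at `Γ_K`, `inf = restrictedInf`, `∂_T = ExtPresentation.boundary` of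
`T` and `presSharp f = e₁⁻¹ ≫ f♯ : N₁ ⟶ J̄` — i.e. EXACTLY the argument `(nat y') ∘ boundary … (f' ≫ g)` of `classBarInv K` in the
tree's all-places reciprocity law `hR4_ideleProjection(_of_readoutUnramified)` at `f' := presSharp f`, up to door-c5's sign
convention `nat = -Φ⁻¹ ∘ H¹(κ)`.  Proof: `Inf` is multiplicative on Yoneda products (`inflExtHom_comp/_mk₀`); the last factor and the
counit give `[ι_S ≫ g]` ((b)); `Inf δ_S[f] ∘ [ι_S] = [e₃] ∘ ∂_T(presSharp f)` ((a)); `Inf(nat_S y) ∘ [e₃] = Φ⁻¹(inf y)` ((d)).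
With (★2) `inv_{K_S} = inv_K ∘ counit_* ∘ Inf_{N_S}` (-w6 g11, `IdeleClassBarKSInvariantInflation`) this turns the left-hand
side of (R4)_S into the left-hand side of the all-places (R4).

HONEST FRAMING: `Ext`-bookkeeping over the cited files; no duality statement and no case of BSD is proved here.
AI formalisation, weaker than expert review; established only by the kernel check.

## References
* J. S. Milne, *Arithmetic Duality Theorems*, 2nd ed. (2006), I §4, proof of Thm. 4.10 (p. 58), Lemma 4.13. [MilneADT2006]
* D. Harari, *Galois Cohomology and Class Field Theory*, Universitext, Springer (2020), §4.3 Remark 4.24, Prop. 17.26 (proof),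
  §17.4 (17.1). [Harari2020]
* C. A. Weibel, *An introduction to homological algebra* (1994), §3.4, §10.7. [Weibel1994]
-/

noncomputable section

open NumberField IsDedekindDomain CategoryTheory CategoryTheory.Abelian
open Field (absoluteGaloisGroup)
open Literature.NumberTheory.Automorphic Literature.Algebra.Homology Literature.Algebra.Homology.DiscreteRep
open Literature.NumberTheory.GaloisCohomology
open scoped Classical

namespace Literature.NumberTheory.GaloisRepresentations

namespace IdeleClassBar

open FreePresentation HomDual
open DiscreteGaloisModule (restrictedCohomology restrictedInf)

variable {K : Type} [Field K] [NumberField K]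
variable {M₀ : Type} [AddCommGroup M₀] [TopologicalSpace M₀] [DiscreteTopology M₀] [Finite M₀]
variable (ρ₀ : DiscreteGaloisModule K M₀) (S : Finset (HeightOneSpectrum (𝓞 K)))
  (hur : ramificationSubgroup K (↑S : Set (HeightOneSpectrum (𝓞 K))) ≤ ContinuousRep.ker ρ₀)

omit [NumberField K] in
/-- `Inf` on a Yoneda product out of the trivial module: `Inf_N (α ∘ β) = Inf_N α ∘ Inf_N β` with the first factor in the
`triv`-retyped currency `inflExtHomTriv` (so that it composes with classes out of `triv ℤ` of `C_{Γ_K}` without casts).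
[cite: Weibel1994, §10.7] -/
theorem inflExtHomTriv_comp_eq
    {Y Z : DiscreteRepCat ℤ (GaloisGroupUnramifiedOutside K (↑S : Set (HeightOneSpectrum (𝓞 K))))} {a b c : ℕ}
    (α : Ext (triv (Γ := GaloisGroupUnramifiedOutside K (↑S : Set (HeightOneSpectrum (𝓞 K)))) ℤ) Y a) (β : Ext Y Z b)
    (h : a + b = c) :
    inflExtHomTriv (ramificationSubgroup K (↑S : Set (HeightOneSpectrum (𝓞 K)))) Z c (α.comp β h) =
      (inflExtHomTriv (ramificationSubgroup K (↑S : Set (HeightOneSpectrum (𝓞 K)))) Y a α).comp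
        (inflExtHom (ramificationSubgroup K (↑S : Set (HeightOneSpectrum (𝓞 K)))) Y Z b β) h :=
  inflExtHom_comp (ramificationSubgroup K (↑S : Set (HeightOneSpectrum (𝓞 K)))) α β h

/-- **(a) in the kit's currency** (-w6 g11's `inflExtHom_extClass_comp_mk₀_comp_sharp_id`, with the `Ext` objects spelled as in
the lane's kit: `A = ofContinuousRep (ρ₀.quotientInvariants N_S)`, `δ_S[f] = bdrySHom`, `e₃ = invariantsInclQuot`,
`∂_T = ExtPresentation.boundary`): `Inf δ_S[f] ∘ [ι_S] = [e₃] ∘ ∂_T(presSharp f)` in `Ext¹_{C_{Γ_K}}(Inf A, J̄)`.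
[cite: MilneADT2006, I Thm. 4.10 (proof, p. 58)][cite: Harari2020, §4.3 Remark 4.24, Prop. 17.26 (proof)] -/
theorem inflExtHom_bdrySHom_comp_mk₀_sharp_id
    (f : (presentationComplexS ρ₀ (↑S : Set (HeightOneSpectrum (𝓞 K)))).X₁ ⟶ truncIdeleBarD K S) :
    (inflExtHom (ramificationSubgroup K (↑S : Set (HeightOneSpectrum (𝓞 K))))
        (ofContinuousRep (ρ₀.quotientInvariants (ramificationSubgroup K (↑S : Set (HeightOneSpectrum (𝓞 K))))))
        (truncIdeleBarD K S) 1 (bdrySHom ρ₀ S hur f)).comp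
      (Ext.mk₀ (sharp K S (𝟙 (truncIdeleBarD K S)))) (add_zero 1) =
    (Ext.mk₀ (invariantsInclQuot (ramificationSubgroup K (↑S : Set (HeightOneSpectrum (𝓞 K)))) (ofDiscreteGaloisModule ρ₀))).comp
      (ExtPresentation.boundary (presentationComplex_shortExact ρ₀) (ideleBarD K) (presSharp ρ₀ S hur f)) (zero_add 1) :=
  inflExtHom_extClass_comp_mk₀_comp_sharp_id ρ₀ S hur f

/-- **The `G_S`-side class of (R4)_S read in `C_{Γ_K}`.**  For `f : N₁^S ⟶ I_S` and `y ∈ H¹(G_S, M₀^{N_S})`: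
`Inf_{N_S}(nat_S y ∘ δ_S[f] ∘ [I_S → C_{K_S}]) ≫ [Inf(C̄^{N_S}) ↪ C̄] = Φ⁻¹(inf y) ∘ ∂_T(presSharp f ≫ (J̄ ↠ C̄))` in
`Ext²_{C_{Γ_K}}(ℤ, C̄)` — the argument of `classBarInv K` in the tree's all-places reciprocity law at `f' := presSharp f`
(objects spelled as in the lane's kit: `A = ofContinuousRep (ρ₀.quotientInvariants N_S)`).
[cite: MilneADT2006, I §4, proof of Thm. 4.10 (p. 58)][cite: Harari2020, §4.3 Remark 4.24, Prop. 17.26 (proof)][cite: Weibel1994, §3.4] -/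
theorem inflExtHomTriv_natLayerS_bdryS_truncToClassKSD_comp_invariantsInclQuot
    (f : (presentationComplexS ρ₀ (↑S : Set (HeightOneSpectrum (𝓞 K)))).X₁ ⟶ truncIdeleBarD K S)
    (y : restrictedCohomology ρ₀ (↑S : Set (HeightOneSpectrum (𝓞 K))) 1) :
    (inflExtHomTriv (ramificationSubgroup K (↑S : Set (HeightOneSpectrum (𝓞 K)))) (classBarKSD K S) 2
        (((RestrictedExtLayer.natLayerS ρ₀ (↑S : Set (HeightOneSpectrum (𝓞 K))) y).comp (bdrySHom ρ₀ S hur f)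
            (rfl : 1 + 1 = 2)).comp (Ext.mk₀ (truncToClassKSD K S)) (add_zero 2))).comp
      (Ext.mk₀ (invariantsInclQuot (ramificationSubgroup K (↑S : Set (HeightOneSpectrum (𝓞 K)))) (classBarD K))) (add_zero 2) =
    ((OpenLayer.extOneEquiv ρ₀).symm (restrictedInf ρ₀ (↑S : Set (HeightOneSpectrum (𝓞 K))) 1 y)).comp
      (ExtPresentation.boundary (presentationComplex_shortExact ρ₀) (classBarD K)
        (presSharp ρ₀ S hur f ≫ (ideleClassLimitShortComplex K).g)) (rfl : 1 + 1 = 2) := by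
  -- `Inf` is multiplicative on Yoneda products and sends `[h]` to `[Inf h]`
  rw [inflExtHomTriv_comp_eq, inflExtHomTriv_comp_eq, inflExtHom_mk₀]
  -- (b): the last factor followed by the counit is `[ι_S ≫ g] = [ι_S] ∘ [g]`
  rw [ext_comp_mk₀_inflKS_map_truncToClassKSD_comp_mk₀_invariantsInclQuot, ← Ext.mk₀_comp_mk₀]
  -- reassociate: `((A ∘ B) ∘ ([ι] ∘ [g])) = ((A ∘ (B ∘ [ι])) ∘ [g])`
  rw [← Ext.comp_assoc_of_third_deg_zero, Ext.comp_assoc_of_third_deg_zero (inflExtHomTriv _ _ 1 _)]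
  -- (a): `Inf δ_S[f] ∘ [ι_S] = [e₃] ∘ ∂_T(presSharp f)`
  rw [inflExtHom_bdrySHom_comp_mk₀_sharp_id ρ₀ S hur f]
  -- the remaining steps cross the definitional seams `(presentationComplex ρ₀).X₃ = ofDiscreteGaloisModule ρ₀`,
  -- `(ideleClassLimitShortComplex K).X₂ = ideleBarD K`: term-mode reassociation, (d), and `∂_T(h) ∘ [g] = ∂_T(h ≫ g)`
  have hd := RestrictedExtLayer.extOneEquiv_symm_restrictedInf ρ₀ (↑S : Set (HeightOneSpectrum (𝓞 K))) y
  have hbd := ExtPresentation.boundary_comp (presentationComplex_shortExact ρ₀) (presSharp ρ₀ S hur f)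
    (ideleClassLimitShortComplex K).g
  exact (congrArg (fun w : Ext (triv (Γ := absoluteGaloisGroup K) ℤ) (ideleBarD K) 2 =>
            w.comp (Ext.mk₀ (ideleClassLimitShortComplex K).g) (add_zero 2))
          ((Ext.comp_assoc_of_second_deg_zero _
            (Ext.mk₀ (invariantsInclQuot (ramificationSubgroup K (↑S : Set (HeightOneSpectrum (𝓞 K)))) (ofDiscreteGaloisModule ρ₀)))
            (ExtPresentation.boundary (presentationComplex_shortExact ρ₀) (ideleBarD K) (presSharp ρ₀ S hur f))
            (rfl : 1 + 1 = 2)).symm.trans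
            (congrArg (fun w : Ext (triv (Γ := absoluteGaloisGroup K) ℤ) (ofDiscreteGaloisModule ρ₀) 1 =>
              w.comp (ExtPresentation.boundary (presentationComplex_shortExact ρ₀) (ideleBarD K) (presSharp ρ₀ S hur f))
                (rfl : 1 + 1 = 2)) hd.symm))).trans
      ((Ext.comp_assoc_of_third_deg_zero _ _ _ (rfl : 1 + 1 = 2)).trans
        (congrArg (fun w => ((OpenLayer.extOneEquiv ρ₀).symm
            (restrictedInf ρ₀ (↑S : Set (HeightOneSpectrum (𝓞 K))) 1 y)).comp w (rfl : 1 + 1 = 2)) hbd.symm))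

end IdeleClassBar

end Literature.NumberTheory.GaloisRepresentations

end
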